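import Literature.AnabelianGeometry.SemiGraphs.ThetaRayAnchorFreeGeneralPair
import Literature.AnabelianGeometry.SemiGraphs.TemperedMaximalCompactAnchoredOfLocallyFinite
import Literature.AnabelianGeometry.SemiGraphs.TemperedEdgeLikeIsInfVerticialHolds
import HarnessLib

/-!
# [SemiAnbd] Thm 3.7 (iv): the typed clause 2 HOLDS VERBATIM at the countermodel `𝒢_θ(p,n)` (typed-form
# audit, row «B9-GENERAL-PAIR», corollary)

Mochizuki, *Semi-graphs of anabelioids*, Publ. RIMS **42** (2006), §3, Theorem 3.7 (iv) p. 41 ("The nontrivial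
intersections of two distinct maximal compact subgroups of `π₁^temp(𝒢)` are precisely the edge-like
subgroups") [cite: MochizukiSemiAnbd2006, Thm 3.7(iv) p.41].

PROOF-ONLY file (abc-iut cell, layer L3, seat abc-iut-L3-d4 gen 7; row «B9-GENERAL-PAIR@𝒢_θ» (L3-lead γ61);
frontier / erratum-grade label, OUTSIDE the [IUTchIII] Cor. 3.12 cone; 0 definitions, no named fact).  The
cell's ∀-countable typing F-1750 `MaximalCompactIffVerticial` is REFUTED at `𝒢_θ` through its clause 1
(abc-iut-w6-d120 p443103: an anchor-free maximal compact subgroup exists).  Its clause 2, direction (⇒) —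
«a non-trivial intersection of two DISTINCT maximal compact subgroups is an edge-like subgroup of a closed
edge» — is here PROVED at `𝒢_θ(p,n)` (canonical chart, every schedule `n_k → ∞`) for EVERY pair:

* `thetaRayFreeProP_maximalCompact_inf_mem_edgeLikeSubgroups` — if one of the two is ANCHORED it is the
  locally-finite theorem of abc-iut-w6-d062 (p449612,
  `exists_mem_edgeLikeSubgroups_of_maximalCompact_inf_of_anchored_of_isLocallyFinite`, the ray being locally
  finite); if `K₁` is ANCHOR-FREE the two cannot meet at all (abc-iut-L3-d4 gen 7's
  `thetaRayFreeProP_maximalCompact_eq_of_anchorFree_of_inf_ne_bot`: they would be equal);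
* `thetaRayFreeProP_maximalCompact_inf_eq_bot_of_anchorFree_of_ne` — the anchor-free reading: an anchor-free
  maximal compact subgroup of `π₁^temp(𝒢_θ)` meets every OTHER maximal compact subgroup trivially;
* `thetaRayFreeProP_maximalCompactIffVerticial_clause_two` — **the typed clause 2 VERBATIM (iff) at
  `𝒢_θ(p,n)`**, (⇐) by abc-iut-f-173's universal `edgeLikeIsInfVerticialAt_holds` and «verticial ⇒ maximal
  compact» at locally finite graphs (abc-iut-w6-d062): so the typed Thm 3.7 (iv) fails at `𝒢_θ` in clause 1
  ONLY.

Nothing of [SemiAnbd] is asserted; nothing bears on [IUTchIII] Cor. 3.12; a theorem at OUR carrier `𝒢_θ` ≠ a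
claim about print's finite `𝔾`; typed ≠ proved.
-/

noncomputable section

namespace Literature.AnabelianGeometry.SemiGraphs

open CategoryTheory Filter Topology Multiplicative
open ProfiniteSemiGraph
open Literature.AnabelianGeometry.SemiGraphs.FreeProPRankTwo

namespace ProfiniteSemiGraph

variable (p : ℕ) [hp : Fact p.Prime] (n : ℕ → ℕ)

/-- `Thm37Hypotheses 𝒢_θ(p, n)` (re-assembled as in the parent files). [cite: MochizukiSemiAnbd2006, Thm 3.7 p.40] -/
private theorem thm37θc : (thetaRayFreeProP p n).Thm37Hypotheses :=
  thetaRayFreeProP_thm37Hypotheses p n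
    (thetaRayFreeProP_isGaloisCountable p (α p) (α_ofAdd_one p) (fun m => θHom p m)
      (fun m => (θ p m).bijective) n)
    (thetaRayFreeProP_isQuasiCoherent p (α p) (α_ofAdd_one p) (fun m => θHom p m)
      (fun m => (θ p m).bijective) n)
    (thetaRayFreeProP_isTotallyElevated_concrete p n)
    (thetaRayFreeProP_isTotallyAloof_concrete p n)
    (thetaRayFreeProP_isTotallyEstranged_concrete p n)

/-- **An anchor-free maximal compact subgroup of `π₁^temp(𝒢_θ(p,n))` meets every other maximal compact
subgroup trivially.** [cite: MochizukiSemiAnbd2006, Thm 3.7(iv) p.41] -/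
theorem thetaRayFreeProP_maximalCompact_inf_eq_bot_of_anchorFree_of_ne (hn : Tendsto n atTop atTop)
    (h36 : (thetaRayFreeProP p n).Prop36Hypotheses)
    (K₁ K₂ : Subgroup ((thetaRayFreeProP p n).temperedPiChart h36).G)
    (hK₁ : IsMaximalCompactSubgroup K₁) (hK₂ : IsMaximalCompactSubgroup K₂)
    (hfree : ∀ (v : ℕ) (H : Subgroup ((thetaRayFreeProP p n).temperedPiChart h36).G),
      H ∈ verticialSubgroups ((thetaRayFreeProP p n).temperedPiChart h36) v → K₁ ⊓ H = ⊥)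
    (hne : K₁ ≠ K₂) : K₁ ⊓ K₂ = ⊥ := by
  by_contra h
  exact hne (thetaRayFreeProP_maximalCompact_eq_of_anchorFree_of_inf_ne_bot p n hn h36 K₁ K₂ hK₁ hK₂ hfree h)

/-- **THM 3.7 (iv) CLAUSE 2 (⇒) AT `𝒢_θ(p,n)` FOR EVERY PAIR**: at the canonical `π₁^temp(𝒢_θ(p,n))` (every
schedule `n_k → ∞`), the non-trivial intersection of two DISTINCT maximal compact subgroups is an edge-like
subgroup of a closed edge of the ray. [cite: MochizukiSemiAnbd2006, Thm 3.7(iv) p.41] -/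
theorem thetaRayFreeProP_maximalCompact_inf_mem_edgeLikeSubgroups (hn : Tendsto n atTop atTop)
    (h36 : (thetaRayFreeProP p n).Prop36Hypotheses)
    (K₁ K₂ : Subgroup ((thetaRayFreeProP p n).temperedPiChart h36).G)
    (hK₁ : IsMaximalCompactSubgroup K₁) (hK₂ : IsMaximalCompactSubgroup K₂) (hne : K₁ ≠ K₂) (hL : K₁ ⊓ K₂ ≠ ⊥) :
    ∃ e : (thetaRayFreeProP p n).graph.Edge, (thetaRayFreeProP p n).graph.IsClosedEdge e ∧
      K₁ ⊓ K₂ ∈ edgeLikeSubgroups ((thetaRayFreeProP p n).temperedPiChart h36) e := by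
  have h37 : (thetaRayFreeProP p n).Thm37Hypotheses := thm37θc p n
  by_cases hanch : ∃ (v : ℕ) (H : Subgroup ((thetaRayFreeProP p n).temperedPiChart h36).G),
      H ∈ verticialSubgroups ((thetaRayFreeProP p n).temperedPiChart h36) v ∧ K₁ ⊓ H ≠ ⊥
  · -- `K₁` anchored: the locally finite theorem (abc-iut-w6-d062)
    obtain ⟨v, H, hH, hKH⟩ := hanch
    exact (thetaRayFreeProP p n).exists_mem_edgeLikeSubgroups_of_maximalCompact_inf_of_anchored_of_isLocallyFinite
      h37 SemiGraph.ray_isLocallyFinite _ hK₁ hK₂ hne hL hH hKH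
  · -- `K₁` anchor-free: the two cannot meet
    push Not at hanch
    exact absurd (thetaRayFreeProP_maximalCompact_inf_eq_bot_of_anchorFree_of_ne p n hn h36 K₁ K₂ hK₁ hK₂
      (fun v H hH => hanch v H hH) hne) hL

/-- **THE TYPED CLAUSE 2 OF THM 3.7 (iv), VERBATIM, AT `𝒢_θ(p,n)`** (the second conjunct of the cell's named
fact `MaximalCompactIffVerticial` instantiated at `𝒢_θ(p,n)` and its canonical chart): a non-trivial subgroup
is the intersection of two distinct maximal compact subgroups IFF it is an edge-like subgroup of a closed edge.
(⇒) is `thetaRayFreeProP_maximalCompact_inf_mem_edgeLikeSubgroups`; (⇐) is abc-iut-f-173's universal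
`edgeLikeIsInfVerticialAt_holds` (edge-like = intersection of the two end verticial subgroups) with «verticial ⇒
maximal compact» at the locally finite ray (abc-iut-w6-d062).  So the typed Thm 3.7 (iv) fails at `𝒢_θ` in
clause 1 ONLY. [cite: MochizukiSemiAnbd2006, Thm 3.7(iv) p.41] -/
theorem thetaRayFreeProP_maximalCompactIffVerticial_clause_two (hn : Tendsto n atTop atTop)
    (h36 : (thetaRayFreeProP p n).Prop36Hypotheses)
    (L : Subgroup ((thetaRayFreeProP p n).temperedPiChart h36).G) (hL : L ≠ ⊥) :
    (∃ K₁ K₂ : Subgroup ((thetaRayFreeProP p n).temperedPiChart h36).G,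
        IsMaximalCompactSubgroup K₁ ∧ IsMaximalCompactSubgroup K₂ ∧ K₁ ≠ K₂ ∧ L = K₁ ⊓ K₂) ↔
      ∃ e : (thetaRayFreeProP p n).graph.Edge, (thetaRayFreeProP p n).graph.IsClosedEdge e ∧
        L ∈ edgeLikeSubgroups ((thetaRayFreeProP p n).temperedPiChart h36) e := by
  have h37 : (thetaRayFreeProP p n).Thm37Hypotheses := thm37θc p n
  constructor
  · rintro ⟨K₁, K₂, hK₁, hK₂, hne, rfl⟩
    exact thetaRayFreeProP_maximalCompact_inf_mem_edgeLikeSubgroups p n hn h36 K₁ K₂ hK₁ hK₂ hne hL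
  · rintro ⟨e, he, hLe⟩
    obtain ⟨v₁, v₂, H₁, H₂, hH₁, hH₂, hne, rfl⟩ :=
      edgeLikeIsInfVerticialAt_holds (thetaRayFreeProP p n) h37 _ e he L hLe hL
    exact ⟨H₁, H₂,
      (thetaRayFreeProP p n).isMaximalCompactSubgroup_of_mem_verticialSubgroups_of_isLocallyFinite h37
        SemiGraph.ray_isLocallyFinite _ hH₁,
      (thetaRayFreeProP p n).isMaximalCompactSubgroup_of_mem_verticialSubgroups_of_isLocallyFinite h37
        SemiGraph.ray_isLocallyFinite _ hH₂, hne, rfl⟩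

end ProfiniteSemiGraph

end Literature.AnabelianGeometry.SemiGraphs

end
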